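import Mathlib
import HarnessLib
import Literature.Computability.Complexity.Space
import Summits.PneNP.PneNP.Theses.UniformStream
import Summits.PneNP.PneNP.Theorems.UniformStreamUniformStreamLBStubSimulation
import Summits.PneNP.PneNP.Theorems.UniformStreamUniformStreamLBStubTransfer
import Summits.PneNP.PneNP.Theorems.UniformStreamUniformStreamLBStubBlockProduct
import Summits.PneNP.PneNP.Theorems.UniformStreamUniformStreamLBStubTruthTableBlocks
import Summits.PneNP.PneNP.Theorems.UniformStreamUniformStreamLBStubFamily
import Summits.PneNP.PneNP.Theorems.UniformStreamUniformStreamLBStubMixedCount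
import Summits.PneNP.PneNP.Theorems.UniformStreamUniformStreamLBLowLevels
import Summits.PneNP.PneNP.Theorems.UniformStreamUniformStreamLBSummitHard

/-!
# Line `birth` (v7, lead c3) — skeleton for the crux `UniformStreamLB` (stmt-PneNP-16045)

Route `UniformStream` (route-PneNP-UniformStream), crux (rank 2)
`UniformStreamLB := ∃ s time-constructible, ∀ c, MCSP[s] has NO uniform one-pass streaming decider
with space and per-machine step budget B_c(N) = s(⌊log₂ N⌋)^c + c`.

THE LINE = TRANSFER TO THE STANDARD UNIFORM CLASS `DTISP` (planner `birth`):
(1) SIMULATION `stub_simulation` — a uniform one-pass streaming decider within budget `S` is ONE small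
simultaneous time–space machine: the decided language lies in
`DTISP((N+1)·(S N + ⌊log₂N⌋ + 1), S N + ⌊log₂N⌋ + 1)`. PROVED: wave 1 landed its four pieces
`stub_dispatch` (p148888), `stub_incrementer` (p148047), `stub_pairFormer` (p148210), `stub_streamLoop`
(p151918 + p149996/p151139/p151455) under `Theorems/UniformStreamUniformStreamLBStub*.lean`, and the glue
(round machine = `dispatch (dispatch Minc M₀) (dispatch (pairFormer ∘ M₁) M₂)`, budgets `C·(S N+⌊log₂N⌋+1)`)
is `Theorems/UniformStreamUniformStreamLBStubSimulation.lean` (registered here as `stub_simulation`,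
LANDED p152730).
(2) TRANSFER `stub_transfer` — pure budget arithmetic: with `s(n) ≥ n` (time-constructible) the budget
`B_c` lands inside `DTISP(N·s(⌊log₂N⌋)^(c+1), s(⌊log₂N⌋)^(c+1))`, so the `DTISP` lower bound at
exponent `c+1` forbids the streaming decider at exponent `c` (`Theorems/…StubTransfer.lean`, LANDED p153228).
(3) THE OPEN CONTENT `stub_MCSP_not_mem_DTISP` (C⁺, held by the lead; OPEN PROBLEM): some
time-constructible `s` has `MCSP[s] ∉ DTISP(N·s(⌊log₂N⌋)^c, s(⌊log₂N⌋)^c)` for every `c`.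
Diagnosis (lead, 2026-08-17): strictly stronger than the crux; by the refuter's bracket
(`Theorems/UniformStreamLB/Negative/LargeSizeNoWitness.lean`: any witness has `n ≤ s n < 5·2ⁿ-4`
somewhere, and for `s ≥ univBound` the matrix fails) and by `∀ c`, a witness must have `s(n) = 2^{o(n)}`
along a subsequence, where NO unconditional lower bound of this type is known: the only unconditional
one-tape / streaming lower bounds for `MCSP[s]` (Cheraghchi–Hirahara–Myrisiotis–Yoshida 2022, Thms 2–3,
via PRGs against small-space machines) need `s = 2^{(1-o(1))n}`, where the `∀ c` clause would assert
`MCSP[s] ∉` (essentially) `P`; FLvMV/Williams alternation trading needs an `NTIME[n]`-hard source reduced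
INTO `MCSP[s]` in quasi-linear time and small space (route child `StreamHard`, open; Murray–Williams
2017 give consequences, not constructions).

* `UniformStreamLB_of : UniformStreamLB` — the crux BY NAME from the three declared stubs.

(4) CALIBRATION FROM BELOW (lead c2, 2026-08-17; registered sub-goals, NOT part of the composition):
the matrix `∀ c, ¬∃ (A, M₀, M₁, M₂) within budget s(⌊log₂N⌋)^c + c` splits by LEVEL `c`; for the natural
witness `s = id` the levels `c ≤ 1` hold UNCONDITIONALLY and NON-UNIFORMLY (`uniformStreamLB_levels_le_one`,
from `lowLevels`: at `N₀ = 2^{2k+6}`, `k = 2^K`, `K ≥ 200`, no one-pass algorithm with `≤ ⌊log₂N₀⌋ + 1`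
state bits decides `MCSP[n ↦ n]`), by a block-product fooling argument: the `k^k` cheap functions
`⋁ᵢ (xᵢ ∧ x_{k+a(i)})` (`stub_family`) give constant 64-block words in the language
(`stub_truthTable_blocks`); pigeonhole on the 63 intermediate states (`stub_blockProduct`) forces `|T|^64`
mixed words into `MCSP[n ↦ n] ∩ {0,1}^{N₀}`, more than the `(2n₀+2)^{7n₀+2}` functions of circuit size
`≤ n₀` (`stub_mixed_count`, `stub_arith`). Levels `c ≥ 2..4` carry a NON-uniform algorithm (Nerode
ceiling, banked at exponent 60: `uniformStream_nerodeCeilingMCSP_proof`), so every level the open stub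
must still supply is uniformity-essential.

(5) CALIBRATION FROM ABOVE — THE OPEN STUB IS SUMMIT-HARD (lead c1 p156286; lead c3 p164841; registered
sub-goal `stub_pneNP_of_MCSP_not_mem_DTISP`, NOT part of the composition): inside the tree,
`HardPRGExist ⟹ C⁺` (`MCSP_not_mem_DTISP_of_hardPRG`) and `C⁺ ⟹ UniformStreamLB ⟹ PneNP`
(`stub_transfer ∘ stub_simulation`; route deciding theorem `closes` + the LANDED magnification crux
`uniformStream_uniformMagnification_proof`, stmt-PneNP-16047). So a sorry-free proof of the open stub is a Lean
proof of `P ≠ NP`, and a refutation of it refutes `2^{k^ε}`-hard PRGs: no reshaping of this (or any) line can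
leave a stub below the summit; even the `s = id`, level-`≥ 3` slice is summit-hard
(`pneNP_of_MCSP_id_not_mem_DTISP_high`). Re-audit of the `∃ s` freedom (lead c3): choosing an exotic size
function cannot diagonalise against the uniform deciders — time-constructibility makes `n ↦ s(n)` computable by
the init machine within its own budget (time and space `O(s(n)) ≤ s(n)^c + c`), so every decider may assume `s`
known; together with the refuter's window `n ≤ s(n) < 5·2ⁿ - 4` the crux is exactly MMW's hypothesis.
presearch (2026-08-17, corpus fts+vec and galaxy): no unconditional uniform streaming / `DTISP` lower bound of the
`∀ c` shape for `MCSP[s]` at any `s = 2^{o(n)}` is in print (CHMY22 Thms 2–3: one-tape `N^{1.99}` at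
`s = 2^{(1-o(1))n}`, finitely many levels; Fu 2020 arXiv:2003.00669 and Atserias–Müller 2025 arXiv:2503.24061:
magnification theorems, no lower bounds).

Disproof used: none exists (`ledger crux ls`, 2026-08-17T13:47Z); Negatives read:
`UniformStreamLB/Negative/{UniformMachines,LargeSizeNoWitness,VacuousWithoutTC}.lean` (refuter
crux-attack 2026-08-17: the crux survives; content window `n ≤ s n < 5·2ⁿ-4`). Leads
prover-line-stmt-PneNP-16045-0 / -c1-0 / -c2-0 / -c3-0, 2026-08-17 (v1: planner-skel-stmt-PneNP-16045-0; v2: four-stub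
split; v5–v6: calibration from below; v7: calibration from above).
-/

set_option linter.dupNamespace false
set_option linter.unusedVariables false

noncomputable section

namespace Summit.PneNP.PneNP.Cruxes.UniformStreamLB.Birth

open Literature.Computability.Complexity Literature.Computability.MetaComplexity
open Summit.PneNP.PneNP.Theses.UniformStream

/-! ## The registered stubs -/

/-- **Stub SIM (`stub_simulation`; PROVED by wave 1 + glue, lands as
`Theorems/UniformStreamUniformStreamLBStubSimulation.lean`): uniform one-pass streaming within budget `S`
is inside `DTISP((N+1)·(S N + ⌊log₂N⌋ + 1), S N + ⌊log₂N⌋ + 1)`.** [McKay–Murray–Williams 2019, §2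
(streaming model); Arora–Barak 2009, Def. 5.10 (TISP), §1.3; folklore simulation] [folklore] -/
theorem stub_simulation :
    ∀ (S : ℕ → ℕ) (L : Language Bool),
      (∃ (A : Literature.Computability.MetaComplexity.StreamingAlgorithm)
          (M₀ M₁ M₂ : Turing.TM2ComputableAux Bool Bool),
        A.HasSpace S ∧
        (∀ N : ℕ, M₀.OutputsWithin (Computability.encodeNat N) (A.init N) (S N)) ∧
        (∀ (N : ℕ) (st : List Bool) (b : Bool), st.length ≤ S N →
          M₁.OutputsWithin (Literature.Computability.Complexity.boolPair st [b]) (A.update N st b) (S N)) ∧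
        (∀ (N : ℕ) (st : List Bool), st.length ≤ S N →
          M₂.OutputsWithin st (Computability.encodeBool (A.accept N st)) (S N)) ∧
        A.Decides L) →
      L ∈ Literature.Computability.Complexity.DTISP (fun N => (N + 1) * (S N + Nat.log 2 N + 1))
        (fun N => S N + Nat.log 2 N + 1) :=
  Summit.PneNP.PneNP.Theorems.UniformStreamLB.Birth.stub_simulation

/-- **Stub TRANSFER (`stub_transfer`; PROVED in the skeleton v2 seam, lands as
`Theorems/UniformStreamUniformStreamLBStubTransfer.lean`): the simulation statement and the `DTISP`
lower bound at every exponent give the crux's body** (budget arithmetic: with `s(n) ≥ n`,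
`(N+1)(s(L)^c + c + L + 1) ≤ K·N·s(L)^(c+1) + K` and `s(L)^c + c + L + 1 ≤ K·s(L)^(c+1) + K`,
`L = ⌊log₂N⌋`, `K = (c+3)(s(0)^(c+1)+3)`; `DTISP` absorbs `K`). [folklore] -/
theorem stub_transfer :
    (∀ (S : ℕ → ℕ) (L : Language Bool),
      (∃ (A : Literature.Computability.MetaComplexity.StreamingAlgorithm)
          (M₀ M₁ M₂ : Turing.TM2ComputableAux Bool Bool),
        A.HasSpace S ∧
        (∀ N : ℕ, M₀.OutputsWithin (Computability.encodeNat N) (A.init N) (S N)) ∧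
        (∀ (N : ℕ) (st : List Bool) (b : Bool), st.length ≤ S N →
          M₁.OutputsWithin (Literature.Computability.Complexity.boolPair st [b]) (A.update N st b) (S N)) ∧
        (∀ (N : ℕ) (st : List Bool), st.length ≤ S N →
          M₂.OutputsWithin st (Computability.encodeBool (A.accept N st)) (S N)) ∧
        A.Decides L) →
      L ∈ Literature.Computability.Complexity.DTISP (fun N => (N + 1) * (S N + Nat.log 2 N + 1))
        (fun N => S N + Nat.log 2 N + 1)) →
    (∃ s : ℕ → ℕ, Literature.Computability.Complexity.IsTimeConstructible s ∧ ∀ c : ℕ,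
      Literature.Computability.MetaComplexity.MCSPSize s ∉
        Literature.Computability.Complexity.DTISP (fun N => N * s (Nat.log 2 N) ^ c)
          (fun N => s (Nat.log 2 N) ^ c)) →
    ∃ s : ℕ → ℕ, Literature.Computability.Complexity.IsTimeConstructible s ∧ ∀ c : ℕ,
      ¬ ∃ (A : Literature.Computability.MetaComplexity.StreamingAlgorithm)
          (M₀ M₁ M₂ : Turing.TM2ComputableAux Bool Bool),
        A.HasSpace (fun N => s (Nat.log 2 N) ^ c + c) ∧
        (∀ N : ℕ, M₀.OutputsWithin (Computability.encodeNat N) (A.init N) (s (Nat.log 2 N) ^ c + c)) ∧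
        (∀ (N : ℕ) (st : List Bool) (b : Bool), st.length ≤ s (Nat.log 2 N) ^ c + c →
          M₁.OutputsWithin (Literature.Computability.Complexity.boolPair st [b]) (A.update N st b)
            (s (Nat.log 2 N) ^ c + c)) ∧
        (∀ (N : ℕ) (st : List Bool), st.length ≤ s (Nat.log 2 N) ^ c + c →
          M₂.OutputsWithin st (Computability.encodeBool (A.accept N st)) (s (Nat.log 2 N) ^ c + c)) ∧
        A.Decides (Literature.Computability.MetaComplexity.MCSPSize s) :=
  Summit.PneNP.PneNP.Theorems.UniformStreamLB.Birth.stub_transfer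

/-- **Stub 2 (the transferred lower bound C⁺; OPEN, held by the lead): for some time-constructible
`s`, `MCSP[s]` is not decidable in simultaneous time `O(N·s(⌊log₂N⌋)^c)` and space
`O(s(⌊log₂N⌋)^c)`, for any `c`.** Stronger than the crux (two-way input); the arena of
alternation-trading lower bounds. [McKay–Murray–Williams 2019, Thm 1.3 (the streaming hypothesis it
strengthens); Fortnow–Lipton–van Melkebeek–Viglas 2005, doi:10.1145/1101821.1101822 (DTISP
lower-bound method); Cheraghchi–Hirahara–Myrisiotis–Yoshida 2022, Thms 1–3 (what is known
unconditionally and why it stops at `s = 2^{(1-o(1))n}`); Kabanets–Cai 2000, Thm 4 (why believed)] -/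
theorem stub_MCSP_not_mem_DTISP :
    ∃ s : ℕ → ℕ, Literature.Computability.Complexity.IsTimeConstructible s ∧ ∀ c : ℕ,
      Literature.Computability.MetaComplexity.MCSPSize s ∉
        Literature.Computability.Complexity.DTISP (fun N => N * s (Nat.log 2 N) ^ c)
          (fun N => s (Nat.log 2 N) ^ c) := by
  sorry

/-! ## The composition (sorry-free) -/

/-- **THE SKELETON THEOREM.** The crux `Summit.PneNP.PneNP.Theses.UniformStream.UniformStreamLB`, concluded
BY NAME from the declared stubs `stub_simulation`, `stub_transfer` (both LANDED under `Theorems/` and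
discharged above by the landed theorems) and `stub_MCSP_not_mem_DTISP` (the file's only `sorry`: the
open transferred lower bound). [folklore] -/
theorem UniformStreamLB_of : Summit.PneNP.PneNP.Theses.UniformStream.UniformStreamLB :=
  stub_transfer stub_simulation stub_MCSP_not_mem_DTISP

/-! ## Calibration from BELOW (lead c2): the levels `c ≤ 1` of the matrix hold for `s = id`,
unconditionally and non-uniformly — registered sub-goals (NOT part of the composition `UniformStreamLB_of`). -/

/-- (LANDED p159516 as `Theorems/UniformStreamUniformStreamLBStubBlockProduct.lean`.)
**Stub LOW-F (block-product / fooling lemma; generic one-pass combinatorics).** If a streaming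
algorithm with space `S` decides `L`, and every `B`-fold repetition `w^B` of a block `w ∈ W` (all blocks of
length `ℓ`) lies in `L`, then some `T ⊆ W` with `|W| ≤ |T| · 2^{(S(Bℓ)+1)(B-1)}` has ALL its mixed words
`w₀ w₁ ⋯ w_{B-1}` (`wᵢ ∈ T`) in `L` (pigeonhole on the `B-1` intermediate states of the runs on the constant
words; crossing-sequence argument). [folklore] -/
theorem stub_blockProduct (A : StreamingAlgorithm) (S : ℕ → ℕ) (hS : A.HasSpace S)
    (L : Language Bool) (hL : A.Decides L) (B ℓ : ℕ) (hB : 1 ≤ B)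
    (W : Finset (List Bool)) (hW : ∀ w ∈ W, w.length = ℓ)
    (hconst : ∀ w ∈ W, (List.replicate B w).flatten ∈ L) :
    ∃ T : Finset (List Bool), T ⊆ W ∧ W.card ≤ T.card * 2 ^ ((S (B * ℓ) + 1) * (B - 1)) ∧
      ∀ f : Fin B → List Bool, (∀ i, f i ∈ T) → (List.ofFn f).flatten ∈ L :=
  Summit.PneNP.PneNP.Theorems.UniformStreamLB.Birth.stub_blockProduct A S hS L hL B ℓ hB W hW hconst

/-- (LANDED p159233 as `Theorems/UniformStreamUniformStreamLBStubTruthTableBlocks.lean`.)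
**Stub LOW-T (truth tables split into blocks along the top variables).** In the tree's LSB-first
enumeration `boolFunEquivFin`, the truth table of an `(m+j)`-variable function is the concatenation, over
the `2^j` values `t` of the top `j` variables (in the order `boolFunEquivFin j`), of the truth tables of its
restrictions to the low `m` variables. [folklore] -/
theorem stub_truthTable_blocks (m j : ℕ) (G : Fin (2 ^ j) → (Fin m → Bool) → Bool) :
    truthTable (fun x : Fin (m + j) → Bool =>
        G (boolFunEquivFin j fun i => x (Fin.natAdd m i)) fun i => x (Fin.castAdd j i)) =
      (List.ofFn fun t : Fin (2 ^ j) => truthTable (G t)).flatten :=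
  Summit.PneNP.PneNP.Theorems.UniformStreamLB.Birth.stub_truthTable_blocks m j G

/-- (LANDED p159238 as `Theorems/UniformStreamUniformStreamLBStubFamily.lean`.)
**Stub LOW-G (a large family of cheap functions).** The `k^k` functions
`g_a(x) = ⋁_{i<k} (x_i ∧ x_{k+a(i)})`, `a : [k] → [k]`, on `2k` variables are pairwise distinct, and each —
read on the low `2k` of `2k + j` variables — has a `B₂`-circuit with at most `2k + 2` gates. [folklore] -/
theorem stub_family (k j : ℕ) (hk : 1 ≤ k) :
    ∃ g : (Fin k → Fin k) → (Fin (2 * k) → Bool) → Bool, Function.Injective g ∧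
      ∀ a, circuitSizeOver B2 (fun x : Fin (2 * k + j) → Bool => g a fun i => x (Fin.castAdd j i)) ≤
        2 * k + 2 :=
  Summit.PneNP.PneNP.Theorems.UniformStreamLB.Birth.stub_family k j hk

/-- (LANDED p159356 as `Theorems/UniformStreamUniformStreamLBStubMixedCount.lean`.)
**Stub LOW-C (counting the mixed words).** If every mixed word of `2^j` blocks from `T` (blocks of
length `2^m`) lies in `MCSP[n ↦ n]`, then `|T|^{2^j}` is at most the number of `(m+j)`-variable functions of
circuit complexity `≤ m + j`, hence `≤ (2(m+j)+2)^{7(m+j)+2}` (the tree's circuit-code count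
`card_circuitCode_le_pow`). [cite: AroraBarakCC2009, Thm. 6.21 (proof, p. 116)] -/
theorem stub_mixed_count (m j : ℕ) (T : Finset (List Bool)) (hT : ∀ w ∈ T, w.length = 2 ^ m)
    (hmix : ∀ f : Fin (2 ^ j) → List Bool, (∀ i, f i ∈ T) →
      (List.ofFn f).flatten ∈ MCSPSize fun n => n) :
    T.card ^ (2 ^ j) ≤ (2 * (m + j) + 2) ^ (7 * (m + j) + 2) :=
  Summit.PneNP.PneNP.Theorems.UniformStreamLB.Birth.stub_mixed_count m j T hT hmix

/-- (LANDED p160584 as `Theorems/UniformStreamUniformStreamLBLowLevels.lean`.)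
**Stub LOW-A (the arithmetic of the contradiction at `k = 2^K`, `K ≥ 200`, `j = 6`).** [folklore] -/
theorem stub_arith (K : ℕ) (hK : 200 ≤ K) :
    (2 * (2 * 2 ^ K + 6) + 2) ^ (7 * (2 * 2 ^ K + 6) + 2) * 2 ^ (4032 * (2 * 2 ^ K + 6 + 2)) <
      ((2 ^ K) ^ (2 ^ K)) ^ 64 :=
  Summit.PneNP.PneNP.Theorems.UniformStreamLB.Birth.stub_arith K hK

/-- **The low levels** (LANDED p160584, `Theorems/UniformStreamUniformStreamLBLowLevels.lean`, composed
there from the five LOW stubs exactly as in skeleton v5): some length `N₀` admits no one-pass streaming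
decider of `MCSP[n ↦ n]` with `≤ ⌊log₂N₀⌋ + 1` state bits. [folklore] -/
theorem lowLevels : ∃ N₀ : ℕ, ∀ (A : StreamingAlgorithm) (S : ℕ → ℕ), A.HasSpace S →
    S N₀ ≤ Nat.log 2 N₀ + 1 → ¬ A.Decides (MCSPSize fun n => n) :=
  Summit.PneNP.PneNP.Theorems.UniformStreamLB.Birth.lowLevels

/-- **Levels `c ≤ 1` of the crux matrix have no decider, for `s = id`** (LANDED p160584). [folklore] -/
theorem uniformStreamLB_levels_le_one (c : ℕ) (hc : c ≤ 1) :
    ¬ ∃ (A : StreamingAlgorithm) (M₀ M₁ M₂ : Turing.TM2ComputableAux Bool Bool),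
      A.HasSpace (fun N => Nat.log 2 N ^ c + c) ∧
      (∀ N : ℕ, M₀.OutputsWithin (Computability.encodeNat N) (A.init N) (Nat.log 2 N ^ c + c)) ∧
      (∀ (N : ℕ) (st : List Bool) (b : Bool), st.length ≤ Nat.log 2 N ^ c + c →
        M₁.OutputsWithin (boolPair st [b]) (A.update N st b) (Nat.log 2 N ^ c + c)) ∧
      (∀ (N : ℕ) (st : List Bool), st.length ≤ Nat.log 2 N ^ c + c →
        M₂.OutputsWithin st (Computability.encodeBool (A.accept N st)) (Nat.log 2 N ^ c + c)) ∧
      A.Decides (MCSPSize fun n => n) :=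
  Summit.PneNP.PneNP.Theorems.UniformStreamLB.Birth.uniformStreamLB_levels_le_one c hc

/-! ## Calibration from ABOVE (lead c3): the open stub implies the summit — registered sub-goal
`stub_pneNP_of_MCSP_not_mem_DTISP` (LANDED p164841, `Theorems/UniformStreamUniformStreamLBSummitHard.lean`),
NOT part of the composition `UniformStreamLB_of`. -/

/-- (LANDED p164841.) **The open stub C⁺ is summit-hard**: its registered signature, taken as a hypothesis,
gives `PneNP` (C⁺ ⟹ `UniformStreamLB` by `stub_transfer ∘ stub_simulation` ⟹ `PneNP` by `closes` and
`uniformStream_uniformMagnification_proof`). [cite: MckayMurrayWilliams2019, Thm. 1.3] -/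
theorem stub_pneNP_of_MCSP_not_mem_DTISP (hC : ∃ s : ℕ → ℕ, Literature.Computability.Complexity.IsTimeConstructible s ∧ ∀ c : ℕ, Literature.Computability.MetaComplexity.MCSPSize s ∉ Literature.Computability.Complexity.DTISP (fun N => N * s (Nat.log 2 N) ^ c) (fun N => s (Nat.log 2 N) ^ c)) : PneNP :=
  Summit.PneNP.PneNP.Theorems.UniformStreamLB.SummitHard.stub_pneNP_of_MCSP_not_mem_DTISP hC

/-- **Crux ⟹ summit** (LANDED p164841 as `SummitHard.pneNP_of_uniformStreamLB`). [cite: MckayMurrayWilliams2019, Thm. 1.3] -/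
theorem pneNP_of_uniformStreamLB : Summit.PneNP.PneNP.Theses.UniformStream.UniformStreamLB → PneNP :=
  Summit.PneNP.PneNP.Theorems.UniformStreamLB.SummitHard.pneNP_of_uniformStreamLB

/- ALTERNATIVE COMPOSITION (landed, NOT part of this skeleton): p160584
`Summit.PneNP.PneNP.Theorems.UniformStreamLB.Birth.uniformStreamLB_of_id_high :
  (∀ c ≥ 3, MCSPSize (fun n => n) ∉ DTISP (fun N => N * Nat.log 2 N ^ c) (fun N => Nat.log 2 N ^ c)) →
  UniformStreamLB` — a SHARPER sufficient condition than the open stub C⁺: the `s = id`, level-`≥ 3`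
slice of C⁺ ("`MCSP[log N]` is not in quasi-linear time AND polylog space") already gives the crux, the
levels `c ≤ 1` of the matrix being the unconditional `uniformStreamLB_levels_le_one` and level `c ≥ 2`
coming from level `c+1` of the `DTISP` bound by the landed per-level transfer `transfer_level`. It is kept
out of the registered skeleton because it commits the witness to `s = id`, which the planner's C⁺ (`∃ s`)
deliberately leaves open; a planner re-lining the crux may register it instead of C⁺. -/

end Summit.PneNP.PneNP.Cruxes.UniformStreamLB.Birth

end
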